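import Summits.BirchSwinnertonDyer.BirchSwinnertonDyer.Theorems.LeadingTermPinchPrimeOrderEqRankOfSchneiderShaAt
import Summits.BirchSwinnertonDyer.BirchSwinnertonDyer.Theorems.LeadingTermPinchPrimePinchAtOfAnalyticRankLeOne
import Summits.BirchSwinnertonDyer.BirchSwinnertonDyer.Theorems.LeadingTermPinchPrimeSchneiderOfHasCMRankLeOne
import Summits.BirchSwinnertonDyer.BirchSwinnertonDyer.Theorems.LeadingTermPinchPrimePinchPrimeOfOpenRanges
import Summits.BirchSwinnertonDyer.BirchSwinnertonDyer.Theorems.LeadingTermPinchPrimeOpenStubsOfResidual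
import Literature.NumberTheory.EllipticCurves.ModPIrreducibleCofinite
import Literature.NumberTheory.EllipticCurves.CanonicalPAdicHeightHolds
import Literature.NumberTheory.EllipticCurves.BertrandCMHeightNonvanishing
import Literature.NumberTheory.EllipticCurves.LeadingTerm

/-!
# Crux `PinchPrime` (stmt-BirchSwinnertonDyer-16218), line `SketchIdeator2` — stub G12
# `stub_pinchAt_of_samePrime`: the crux from its MINIMAL (same-prime) residual

Helper file (`--supports stmt-BirchSwinnertonDyer-16218`) for the lead skeleton
`Cruxes/PinchPrime/Lines/SketchIdeator2.lean` (v20, line cycle 5). Prime by prime, and modulo the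
theorem-grade facts, the crux `LeadingTerm.PinchPrime` at a curve `E/ℚ` asks for ONE good ordinary
`p ≥ 5` with `Ш(E/ℚ)[p^∞]` finite AND the canonical cyclotomic `p`-adic height non-degenerate
(necessity: `Negative/ContentOfCrux.leadingTermPinchPrime_iff_schneiderSha_somewhere`; sufficiency
at an irreducible prime: the landed pointwise bridge G1 `stub_orderEqRankOfSchneiderShaAt`). After
the known slices — analytic rank `0` (`L(E,1) ≠ 0`), Mordell–Weil rank `0` (`Reg_p = 1`) and CM
curves of analytic rank `≤ 1` (Bertrand 1984 + Gross–Zagier–Kolyvagin) — the WEAKEST sufficient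
residual is the pair

* (J)  every curve of analytic rank `≥ 2` has ONE good ordinary `p ≥ 5` with `E[p]` irreducible,
       `Ш(E/ℚ)[p^∞]` finite and `Reg_p(E, Dh) ≠ 0` for every canonical datum `Dh`;
* (S″) every non-CM curve of analytic rank `1` has ONE good ordinary `p ≥ 5` with `E[p]`
       irreducible and `Reg_p(E, Dh) ≠ 0` (i.e. `h_p(P) ≠ 0` for a generator `P`: the `∃ p` form
       of Schneider's conjecture, Mazur–Stein–Tate 2006 Conj. 1.1; barrier B6: open in print).

This file proves

* `pinchAt_of_analyticRank_le_one_of_rank_zero_or_hasCM`: every curve OUTSIDE the open ranges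
  (analytic rank `≤ 1`, and rank `0` or CM) satisfies its instance of the crux;
* `two_le_analyticRank_or_of_not_pinchAt`: the shape of a counterexample — analytic rank `≥ 2`,
  or non-CM with analytic rank `=` Mordell–Weil rank `= 1`;
* `stub_pinchAt_of_samePrime` (the registered stub G12): (J) ∧ (S″) ⟹ the crux at every `W`;
* `samePrime_of_residual`: the registered open stubs A′ (cofinite finiteness of `Ш[p^∞]` on
  analytic rank `≥ 2`) and S′ (Schneider non-degeneracy at infinitely many good ordinary `p ≥ 5`
  on Mordell–Weil rank `≥ 1` minus CM-rank-`1`) imply (J) ∧ (S″),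

all modulo the five named facts taken as hypotheses: Perrin-Riou–Schneider
(`Schneider1985_order_charGenerator`), modularity (`exists_isNewformOf`), the main conjecture under
irreducibility (`burungale_castella_skinner_charIdeal_eq_padicLFunction`), Gross–Zagier–Kolyvagin
(`rank_eq_analyticRank_of_analyticRank_le_one`), Bertrand (`bertrand_pairing_self_ne_zero_of_hasCM`).

References: Mazur–Stein–Tate 2006 Conj. 1.1; Balakrishnan–Müller–Stein 2016 Thm 1.7
(Perrin-Riou–Schneider); Darmon 2004 Thm 3.22 (GZK); Bertrand, LNM 1068 (1984) §3 Cor. 1;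
Silverman AEC Cor. IX.6.3 (irreducibility for all but finitely many `p`).
-/

noncomputable section

-- D-0017: single-problem summit, so `Summit.BirchSwinnertonDyer.BirchSwinnertonDyer.…` repeats a
-- namespace BY DESIGN.
set_option linter.dupNamespace false

namespace Summit.BirchSwinnertonDyer.BirchSwinnertonDyer.Cruxes.PinchPrime.FirstLayerStability

open scoped MatrixGroups ModularForm
open CongruenceSubgroup Literature.NumberTheory.EllipticCurves
  Literature.NumberTheory.EllipticCurves.ModularForms
open Summit.BirchSwinnertonDyer.BirchSwinnertonDyer.Theses

/-- **More generally (v17): every curve OUTSIDE the open ranges satisfies its instance of the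
crux** — analytic rank `≤ 1` and (rank `0` or CM): GZK gives `Ш` finite, Schneider at every good
ordinary `p ≥ 5` is `Reg_p = 1` in rank `0` and Bertrand for CM rank `1`, and G7 concludes;
modulo PRS, BCS, modularity, GZK, Bertrand (hypotheses). So a counterexample to the crux, if any,
is a curve of analytic rank `≥ 2`, or a non-CM curve of analytic rank `1` with `h_p(P) = 0` at all
but finitely many good ordinary `p` (barrier B6). [cite: Darmon2004, Thm. 3.22]
[cite: Bertrand1984ThetaCM, §3 Corollaire 1] [cite: BalakrishnanMullerStein2015, Thm. 1.7] -/
theorem pinchAt_of_analyticRank_le_one_of_rank_zero_or_hasCM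
    (hPRS : Schneider1985_order_charGenerator)
    (hBCS : burungale_castella_skinner_charIdeal_eq_padicLFunction)
    (hmod : exists_isNewformOf) (hGZK : rank_eq_analyticRank_of_analyticRank_le_one)
    (hBer : bertrand_pairing_self_ne_zero_of_hasCM)
    (W : WeierstrassCurve ℚ) [W.IsElliptic] [W.IsGloballyMinimal]
    (han : W.analyticRank ≤ 1) (h0 : W.mordellWeilRank = 0 ∨ W.HasCM) :
    ∃ (p : ℕ) (_ : Fact p.Prime), 5 ≤ p ∧ IsOrdinaryAt W p ∧
      ∃ (D : WeierstrassCurve.PAdicHeightData W p), D.IsCanonical ∧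
        ∃ (N : ℕ) (_ : NeZero N) (f : CuspForm (Gamma0 N) 2), IsNewformOf W f ∧
          (padicLFunction f (unitRoot W p : ℚ_[p])).order = W.mordellWeilRank := by
  refine stub_pinchAt_of_analyticRank_le_one_of_schneiderIO hPRS hBCS hmod hGZK W han fun B ↦ ?_
  obtain ⟨p, hpB, hp, h5, hord⟩ := exists_goodOrdinary_five_le_not_mem W B
  refine ⟨p, hpB, hp, h5, hord, fun Dh hDh ↦ ?_⟩
  rcases h0 with h0 | hCM
  · exact schneider_of_mordellWeilRank_eq_zero W p h0 Dh
  · have hrk : W.mordellWeilRank ≤ 1 := by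
      rw [(hGZK W han).1]
      exact han
    exact stub_schneider_of_hasCM_of_rank_le_one hBer W hCM hrk p h5 hord Dh hDh

/-- **Shape of a counterexample** (v18, PROVED; contrapositive of the previous theorem): modulo
PRS, BCS, modularity, GZK and Bertrand, a curve `W` violating its instance of the crux has
analytic rank `≥ 2`, or it is a NON-CM curve of analytic rank `1` = Mordell–Weil rank `1` (whose
generator then has `h_p(P) = 0` at all but finitely many good ordinary `p`, by G7 — barrier B6).
[cite: Darmon2004, Thm. 3.22] [cite: Bertrand1984ThetaCM, §3 Corollaire 1] -/
theorem two_le_analyticRank_or_of_not_pinchAt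
    (hPRS : Schneider1985_order_charGenerator)
    (hBCS : burungale_castella_skinner_charIdeal_eq_padicLFunction)
    (hmod : exists_isNewformOf) (hGZK : rank_eq_analyticRank_of_analyticRank_le_one)
    (hBer : bertrand_pairing_self_ne_zero_of_hasCM)
    (W : WeierstrassCurve ℚ) [W.IsElliptic] [W.IsGloballyMinimal]
    (hW : ¬ ∃ (p : ℕ) (_ : Fact p.Prime), 5 ≤ p ∧ IsOrdinaryAt W p ∧
      ∃ (D : WeierstrassCurve.PAdicHeightData W p), D.IsCanonical ∧
        ∃ (N : ℕ) (_ : NeZero N) (f : CuspForm (Gamma0 N) 2), IsNewformOf W f ∧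
          (padicLFunction f (unitRoot W p : ℚ_[p])).order = W.mordellWeilRank) :
    2 ≤ W.analyticRank ∨
      (W.analyticRank = 1 ∧ W.mordellWeilRank = 1 ∧ ¬ W.HasCM) := by
  by_cases h2 : 2 ≤ W.analyticRank
  · exact Or.inl h2
  have han : W.analyticRank ≤ 1 := by omega
  have hrk : W.mordellWeilRank = W.analyticRank := (hGZK W han).1
  have hnot : ¬ (W.mordellWeilRank = 0 ∨ W.HasCM) := fun h ↦
    hW (pinchAt_of_analyticRank_le_one_of_rank_zero_or_hasCM hPRS hBCS hmod hGZK hBer W han h)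
  have h0 : W.mordellWeilRank ≠ 0 := fun h ↦ hnot (Or.inl h)
  have hCM : ¬ W.HasCM := fun h ↦ hnot (Or.inr h)
  exact Or.inr ⟨by omega, by omega, hCM⟩

/-- **Stub G12 `stub_pinchAt_of_samePrime`** (crux `PinchPrime`, line `SketchIdeator2`): modulo
PRS, modularity, BCS, GZK and Bertrand (hypotheses), the same-prime residual (J) ∧ (S″) implies
the `W`-instance of the crux for every `W` — through the landed pointwise bridge G1 at the prime
supplied by (J) / (S″) (with `Ш` finite by GZK in analytic rank `1`), and through
`pinchAt_of_analyticRank_le_one_of_rank_zero_or_hasCM` elsewhere.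
[cite: BalakrishnanMullerStein2015, Thm. 1.7] [cite: MazurSteinTate2006, Conj. 1.1]
[cite: Darmon2004, Thm. 3.22] -/
theorem stub_pinchAt_of_samePrime :
    Schneider1985_order_charGenerator → exists_isNewformOf →
    burungale_castella_skinner_charIdeal_eq_padicLFunction →
    rank_eq_analyticRank_of_analyticRank_le_one → bertrand_pairing_self_ne_zero_of_hasCM →
    (∀ (W : WeierstrassCurve ℚ) [W.IsElliptic] [W.IsGloballyMinimal], 2 ≤ W.analyticRank →
      ∃ (p : ℕ) (_ : Fact p.Prime), 5 ≤ p ∧ IsOrdinaryAt W p ∧ W.HasIrreducibleModPGaloisRep p ∧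
        Finite (AddCommGroup.primaryComponent W.sha p) ∧
        ∀ Dh : WeierstrassCurve.PAdicHeightData W p, Dh.IsCanonical →
          WeierstrassCurve.SchneiderConjecture Dh) →
    (∀ (W : WeierstrassCurve ℚ) [W.IsElliptic] [W.IsGloballyMinimal], W.analyticRank = 1 →
      ¬ W.HasCM →
      ∃ (p : ℕ) (_ : Fact p.Prime), 5 ≤ p ∧ IsOrdinaryAt W p ∧ W.HasIrreducibleModPGaloisRep p ∧
        ∀ Dh : WeierstrassCurve.PAdicHeightData W p, Dh.IsCanonical →
          WeierstrassCurve.SchneiderConjecture Dh) →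
    ∀ (W : WeierstrassCurve ℚ) [W.IsElliptic] [W.IsGloballyMinimal],
      ∃ (p : ℕ) (_ : Fact p.Prime), 5 ≤ p ∧ IsOrdinaryAt W p ∧
        ∃ (D : WeierstrassCurve.PAdicHeightData W p), D.IsCanonical ∧
          ∃ (N : ℕ) (_ : NeZero N) (f : CuspForm (Gamma0 N) 2), IsNewformOf W f ∧
            (padicLFunction f (unitRoot W p : ℚ_[p])).order = W.mordellWeilRank := by
  intro hPRS hmod hBCS hGZK hBer hJ hS W _ _
  haveI : NeZero (W.conductorNorm ℤ) := ⟨(WeierstrassCurve.conductorNorm_pos_holds (W := W)).ne'⟩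
  -- pointwise bridge at an admissible prime with `Ш_p` finite and Schneider_p
  have key : ∀ (p : ℕ) (_ : Fact p.Prime), 5 ≤ p → IsOrdinaryAt W p →
      W.HasIrreducibleModPGaloisRep p → Finite (AddCommGroup.primaryComponent W.sha p) →
      (∀ Dh : WeierstrassCurve.PAdicHeightData W p, Dh.IsCanonical →
        WeierstrassCurve.SchneiderConjecture Dh) →
      ∃ (p : ℕ) (_ : Fact p.Prime), 5 ≤ p ∧ IsOrdinaryAt W p ∧
        ∃ (D : WeierstrassCurve.PAdicHeightData W p), D.IsCanonical ∧
          ∃ (N : ℕ) (_ : NeZero N) (f : CuspForm (Gamma0 N) 2), IsNewformOf W f ∧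
            (padicLFunction f (unitRoot W p : ℚ_[p])).order = W.mordellWeilRank := by
    intro p hp h5 hord hirr hsha hSch
    obtain ⟨Dh, hDh⟩ := WeierstrassCurve.exists_isCanonical_holds W p h5 hord.1 hord.2
    obtain ⟨f, hf⟩ := hmod W
    exact ⟨p, hp, h5, hord, Dh, hDh, _, inferInstance, f, hf,
      stub_orderEqRankOfSchneiderShaAt hPRS hBCS W p h5 hord hirr hsha Dh hDh (hSch Dh hDh) f hf⟩
  by_cases h2 : 2 ≤ W.analyticRank
  · obtain ⟨p, hp, h5, hord, hirr, hsha, hSch⟩ := hJ W h2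
    exact key p hp h5 hord hirr hsha hSch
  have han : W.analyticRank ≤ 1 := by omega
  by_cases hk : W.mordellWeilRank = 0 ∨ W.HasCM
  · exact pinchAt_of_analyticRank_le_one_of_rank_zero_or_hasCM hPRS hBCS hmod hGZK hBer W han hk
  · have hrk : W.mordellWeilRank = W.analyticRank := (hGZK W han).1
    have h0 : W.mordellWeilRank ≠ 0 := fun h ↦ hk (Or.inl h)
    have hCM : ¬ W.HasCM := fun h ↦ hk (Or.inr h)
    have h1 : W.analyticRank = 1 := by omega
    obtain ⟨p, hp, h5, hord, hirr, hSch⟩ := hS W h1 hCM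
    haveI : Finite W.sha := (hGZK W han).2
    exact key p hp h5 hord hirr inferInstance hSch

/-- **The registered stubs A′, S′ imply the same-prime residual (J), (S″)** (GZK and Bertrand as
hypotheses): on analytic rank `≥ 2`, A′ is cofinite and Schneider holds infinitely often for every
curve (`schneiderIO_of_residual`), so they meet beyond the finitely many reducible primes; on
non-CM analytic rank `1`, GZK gives rank `1` and S′ applies. [cite: Darmon2004, Thm. 3.22]
[cite: MazurSteinTate2006, Conj. 1.1] -/
theorem samePrime_of_residual
    (hGZK : rank_eq_analyticRank_of_analyticRank_le_one)
    (hBer : bertrand_pairing_self_ne_zero_of_hasCM)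
    (hA : ∀ (W : WeierstrassCurve ℚ) [W.IsElliptic] [W.IsGloballyMinimal], 2 ≤ W.analyticRank →
      ∃ B : Finset ℕ, ∀ p ∉ B, ∀ [Fact p.Prime], IsOrdinaryAt W p →
        Finite (AddCommGroup.primaryComponent W.sha p))
    (hS : ∀ (W : WeierstrassCurve ℚ) [W.IsElliptic] [W.IsGloballyMinimal], 1 ≤ W.mordellWeilRank →
      (W.HasCM → 2 ≤ W.mordellWeilRank) → ∀ B : Finset ℕ,
        ∃ p ∉ B, ∃ _ : Fact p.Prime, 5 ≤ p ∧ IsOrdinaryAt W p ∧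
          ∀ Dh : WeierstrassCurve.PAdicHeightData W p, Dh.IsCanonical →
            WeierstrassCurve.SchneiderConjecture Dh) :
    (∀ (W : WeierstrassCurve ℚ) [W.IsElliptic] [W.IsGloballyMinimal], 2 ≤ W.analyticRank →
      ∃ (p : ℕ) (_ : Fact p.Prime), 5 ≤ p ∧ IsOrdinaryAt W p ∧ W.HasIrreducibleModPGaloisRep p ∧
        Finite (AddCommGroup.primaryComponent W.sha p) ∧
        ∀ Dh : WeierstrassCurve.PAdicHeightData W p, Dh.IsCanonical →
          WeierstrassCurve.SchneiderConjecture Dh) ∧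
    (∀ (W : WeierstrassCurve ℚ) [W.IsElliptic] [W.IsGloballyMinimal], W.analyticRank = 1 →
      ¬ W.HasCM →
      ∃ (p : ℕ) (_ : Fact p.Prime), 5 ≤ p ∧ IsOrdinaryAt W p ∧ W.HasIrreducibleModPGaloisRep p ∧
        ∀ Dh : WeierstrassCurve.PAdicHeightData W p, Dh.IsCanonical →
          WeierstrassCurve.SchneiderConjecture Dh) := by
  refine ⟨fun W _ _ h2 ↦ ?_, fun W _ _ h1 hCM ↦ ?_⟩
  · obtain ⟨B₁, hB₁⟩ := hA W h2
    obtain ⟨N, hN⟩ := W.exists_forall_hasIrreducibleModPGaloisRep_of_lt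
    obtain ⟨p, hpB, hp, h5, hord, hSch⟩ :=
      schneiderIO_of_residual hBer hS W (B₁ ∪ Finset.range (N + 1))
    simp only [Finset.mem_union, Finset.mem_range, not_or, not_lt] at hpB
    obtain ⟨hp1, hpN⟩ := hpB
    haveI : Fact p.Prime := hp
    exact ⟨p, hp, h5, hord, hN p (by omega) hp.out, hB₁ p hp1 hord, hSch⟩
  · have han : W.analyticRank ≤ 1 := by omega
    have hrk : W.mordellWeilRank = 1 := by rw [(hGZK W han).1, h1]
    obtain ⟨N, hN⟩ := W.exists_forall_hasIrreducibleModPGaloisRep_of_lt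
    obtain ⟨p, hpB, hp, h5, hord, hSch⟩ :=
      hS W (by omega) (fun h ↦ absurd h hCM) (Finset.range (N + 1))
    have hpN : N < p := by
      have : ¬ p < N + 1 := fun h ↦ hpB (Finset.mem_range.mpr h)
      omega
    haveI : Fact p.Prime := hp
    exact ⟨p, hp, h5, hord, hN p hpN hp.out, hSch⟩

end Summit.BirchSwinnertonDyer.BirchSwinnertonDyer.Cruxes.PinchPrime.FirstLayerStability

end
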